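/-
Copyright (c) 2026 the pub-hodgecm-mathlib formalisation cell (harness21).  Prover seat hodgecm-mathlib-LH7-p06 (g3), req620 Track A «(D-RAM) FOUR-FRAME» squad
((β₂) road (R-36), lane C (RamM) UPPER-LINE RAY PROGRAM of LH7-p10 (g3), file G3: the «Gen» re-issue of ★ p864601 §1 (LH4-p19 (g3)) serving BOTH lanes), 2026-09-05.
-/
import Summits.HodgeConjecture.HodgeConjecture.Theorems.F0P3cDyRamDiagonalCellCleanRegime     -- ★ (LH4-p19 (g0)): `v_map_le_pow_iff` (`|jE c| ≤ |jEϖ|ⁿ ↔ |c| ≤ |ϖ|ⁿ` from `hjv`)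
import HarnessLib

/-!
# Crux `H413`, line LH4 «(D-RAM) FOUR-FRAME» — (β₂) road, RAY bands of BOTH lanes: «DIGIT CONSTANCY, GENERIC `jE`» — ★ p864601 `…UpperRayDigitConstancy` §1
# (`litStar_of_near`, `litStar_iff_of_near`) with the ONE binder swap `hjiso ↦ hjv` (file G3 of LH7-p10 (g3)'s LANE-C RAY PROGRAM v1, 5eec38bd)

Cell `hodgecm-mathlib` (D-0151), FLOOR 0, crux item H413 = `stmt-HodgeConjecture-24833`, route of record `HCCMUnconditional`; squads F0∕P3c∕LH4 + LH7 (hand LH7-p06); lane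
`--supports stmt-HodgeConjecture-24833 --as helper` (count-neutral; pays NO tier-0 row).  THEOREMS ONLY (no `def`, no instance, no notation, no `sorry`, default heartbeats);
★-only imports; states NO law; (β₂) and the RAY-band letters stay HYPOTHESES.
WHAT.  ★ p864601 (LH4-p19 (g3)) proves, in lane B (RamK: `jE` ISOMETRIC, binder `hjiso : ∀ a, |jE a| = |a|`), that the upper-line literal predicate
`LIT⋆(V) :≡ |κ₀ + jE V·ξ₀|·|cA| = |jEϖ|^b ∧ ∃ e ∈ Fix ρ, eΘe = κ̂ρκ̂∕(hρh)` is constant on `|ϖ|^{2d−1}`-balls of σ-fixed digits.  Its proof uses `hjiso` ONLY to transport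
the nearness `|V′ − V| ≤ |ϖ|^{2d−1}` to `|jE(V′ − V)| ≤ |jEϖ|^{2d−1}` and `|ϖ|^{2d−1} < 1` to `|jEϖ|^{2d−1} < 1` (LANEC-RAY-PROGRAM v1 §0) — both available from the
integrality-reflecting letter `hjv : ∀ c, |jE c| ≤ 1 ↔ |c| ≤ 1` (★ `v_map_le_pow_iff`), which BOTH OFF blocks carry (`_hjv`) and which holds in lane C (RamM: `|jE a| = |a|²`)
as well.  THIS FILE = ★ §1 re-issued with the binder swap `(hjiso : …) ↦ (hjv : ∀ c, Valued.v (jE c) ≤ 1 ↔ Valued.v c ≤ 1)` IN PLACE (binder ORDER kept, so callers pass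
arguments positionally exactly as to ★) and `hlt` re-typed on `M`: `(hlt : Valued.v (jE ϖ) ^ (2 * d - 1) < 1)` (the caller has it: `|jEϖ| < 1`); `ϖ ≠ 0` is derived from
the kept binder `hϖ0 : jE ϖ ≠ 0` (no new binder); conclusions BYTE-IDENTICAL to ★.  §2 of ★ (`sphere_iff_of_near`, `ball_mul_iff_of_near`, `psi_iff_of_near`) is lane-free
already — import ★ p864601, not copied here.
* §1 `litStar_of_near` (one direction), HEAD `litStar_iff_of_near`.
HONEST LABEL.  Count-neutral algebra; nothing printed is asserted; no census law is stated; ‹HU_RAY_C♮›∕‹HL_RAY_C♭›∕‹HC_RAY_C♮›, lane B's `hU_ray`∕`hD_ray`∕`hL_ray` payers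
elsewhere, β₂ `stub_law_cleanSgn₂` stay OPEN∕HYPOTHESES; `HC_CM` is proved only modulo the 7 printed citations (2 remaining named inputs: hLiu418 = `stmt-HodgeConjecture-24832`,
h413 = `stmt-HodgeConjecture-24833`) until rung 0 closes.
## References
* [Serre1979] J.-P. Serre, *Local Fields*, GTM 67 (1979): Ch. V §3 Cor. 3 pp. 85–87 (norm groups `U^{(n)} ⊆ N` for `n ≥ 2d − 1`; conductor of `ω`), Ch. XV §2.
* [Rogawski1990] J. D. Rogawski, *Automorphic Representations of Unitary Groups in Three Variables*, Ann. of Math. Stud. 123 (1990): §4.9 Prop. 4.9.1 (b) p. 55.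
* [Kottwitz1986BaseChangeUnits] R. E. Kottwitz, *Base change for unit elements of Hecke algebras*, Compositio Math. 60 (1986): §3 (the digit fibration of a cone cell).
-/

set_option autoImplicit false

noncomputable section

namespace Summit.HodgeConjecture.HodgeConjecture.Cruxes.H413.F0P3cDyRamUpperRayDigitConstancyGen

open scoped Valued WithZero
open WithZero
open Summit.HodgeConjecture.HodgeConjecture.Cruxes.H413.F0P3cDyRamDiagonalCellCleanRegime (v_map_le_pow_iff)

variable {E M : Type} [Field E] [Valued E ℤᵐ⁰] [Field M] [Valued M ℤᵐ⁰] {ρ Θ : M →+* M}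

/-! ## §1 The literal predicate `LIT⋆` is constant on `|ϖ|^{2d−1}`-balls of fixed digits — generic `jE` (`hjv` only) -/

/-- **ONE DIRECTION OF §1's HEAD** (the statement is symmetric in `V, V′`): `LIT⋆ V → LIT⋆ V′` for fixed digits `V, V′` with `|V′ − V| ≤ |ϖ|^{2d−1}`, given the reference pair,
`|ξ₀|·|cA| = |jEϖ|^b` and the norm letter at depth `2d − 1` — ★ `litStar_of_near` with `hjiso ↦ hjv`, `hlt` on `|jEϖ|`. [cite: Serre1979, Ch. V §3 Cor. 3 pp. 85–87] [cite: Rogawski1990, §4.9 Prop. 4.9.1 (b) p. 55] -/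
theorem litStar_of_near {σ : E →+* E} {ϖ : E} {d : ℕ}
    (jE : E →+* M) (hjv : ∀ c, Valued.v (jE c) ≤ 1 ↔ Valued.v c ≤ 1) (hjfix : ∀ z, ρ z = z ↔ ∃ c, jE c = z) (hΘj : ∀ c, Θ (jE c) = jE (σ c))
    (hρρ : ∀ x, ρ (ρ x) = x) (hvρ : ∀ x, Valued.v (ρ x) = Valued.v x) (hΘρ : ∀ x, Θ (ρ x) = ρ (Θ x))
    {κ₀ ξ₀ : M} (hκ₀ : κ₀ + ρ κ₀ = 1) (hΘκ₀ : Θ κ₀ = κ₀) (hξ : ρ ξ₀ = -ξ₀) (hΘξ : Θ ξ₀ = ξ₀) (hξ0 : ξ₀ ≠ 0)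
    {cA hM : M} {b : ℕ} (hRe : Valued.v ξ₀ * Valued.v cA = Valued.v (jE ϖ) ^ b) (hϖ0 : jE ϖ ≠ 0)
    (hdeep : ∀ u : M, ρ u = u → Θ u = u → Valued.v (u - 1) ≤ Valued.v (jE ϖ) ^ (2 * d - 1) → ∃ c : M, ρ c = c ∧ c * Θ c = u)
    {V V' : E} (hσV : σ V = V) (hσV' : σ V' = V') (hnear : Valued.v (V' - V) ≤ Valued.v ϖ ^ (2 * d - 1)) (hlt : Valued.v (jE ϖ) ^ (2 * d - 1) < 1)
    (hL : Valued.v (κ₀ + jE V * ξ₀) * Valued.v cA = Valued.v (jE ϖ) ^ b ∧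
      ∃ e : M, ρ e = e ∧ e * Θ e = (κ₀ + jE V * ξ₀) * ρ (κ₀ + jE V * ξ₀) / (hM * ρ hM)) :
    Valued.v (κ₀ + jE V' * ξ₀) * Valued.v cA = Valued.v (jE ϖ) ^ b ∧
      ∃ e : M, ρ e = e ∧ e * Θ e = (κ₀ + jE V' * ξ₀) * ρ (κ₀ + jE V' * ξ₀) / (hM * ρ hM) := by
  obtain ⟨hLv, e, hρe, he⟩ := hL
  have hρj : ∀ c : E, ρ (jE c) = jE c := fun c => (hjfix _).2 ⟨c, rfl⟩
  have hϖE0 : ϖ ≠ 0 := fun h0 => hϖ0 (by rw [h0, map_zero])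
  have hcA0 : Valued.v cA ≠ 0 := fun h0 => by
    rw [h0, mul_zero] at hRe; exact pow_ne_zero _ ((Valuation.ne_zero_iff _).2 hϖ0) hRe.symm
  set κ : M := κ₀ + jE V * ξ₀ with hκdef
  set η : M := jE (V' - V) * ξ₀ with hηdef
  have hκ' : κ₀ + jE V' * ξ₀ = κ + η := by rw [hκdef, hηdef, map_sub]; ring
  -- sizes: `|κ| = |ξ₀|`, `|η| ≤ |ϖ|^{2d−1}·|ξ₀| < |κ|`
  have hκv : Valued.v κ = Valued.v ξ₀ := mul_right_cancel₀ hcA0 (hLv.trans hRe.symm)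
  have hξpos : (0 : ℤᵐ⁰) < Valued.v ξ₀ := zero_lt_iff.2 ((Valuation.ne_zero_iff _).2 hξ0)
  have hηv : Valued.v η ≤ Valued.v (jE ϖ) ^ (2 * d - 1) * Valued.v κ := by
    rw [hηdef, Valuation.map_mul, hκv]; exact mul_le_mul' ((v_map_le_pow_iff jE hjv hϖE0 (V' - V) (2 * d - 1)).2 hnear) le_rfl
  have hηlt : Valued.v η < Valued.v κ := by
    refine hηv.trans_lt ?_
    calc Valued.v (jE ϖ) ^ (2 * d - 1) * Valued.v κ < 1 * Valued.v κ := by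
          rw [hκv]; exact mul_lt_mul_of_pos_right hlt hξpos
      _ = Valued.v κ := one_mul _
  have hκ0 : κ ≠ 0 := fun h0 => by rw [h0, map_zero] at hκv; exact hξ0 ((Valuation.zero_iff _).1 hκv.symm)
  have hρκ : ρ κ = 1 - κ := by
    rw [hκdef, map_add, map_mul, hρj, hξ, mul_neg, ← hκ₀]; ring
  have hρκ0 : ρ κ ≠ 0 := fun h0 => hκ0 (by rw [← hρρ κ, h0, map_zero])
  have hρη : ρ η = -η := by rw [hηdef, map_mul, hρj, hξ, mul_neg]
  have hΘκ : Θ κ = κ := by rw [hκdef, map_add, map_mul, hΘκ₀, hΘj, hσV, hΘξ]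
  have hΘη : Θ η = η := by rw [hηdef, map_mul, hΘj, map_sub, hσV, hσV', hΘξ, map_sub]
  -- the twist `w = κ′ρκ′ ∕ (κρκ)`
  set w : M := (κ + η) * ρ (κ + η) / (κ * ρ κ) with hwdef
  have hρw : ρ w = w := by
    rw [hwdef, map_div₀, map_mul, map_mul, hρρ, hρρ]; ring
  have hΘw : Θ w = w := by
    rw [hwdef, map_div₀, map_mul, map_mul, hΘρ, hΘρ, map_add, hΘκ, hΘη]
  have hw1 : w - 1 = (η * (ρ κ - κ) - η * η) / (κ * ρ κ) := by
    rw [hwdef, map_add, hρη]; field_simp; ring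
  have hwv : Valued.v (w - 1) ≤ Valued.v (jE ϖ) ^ (2 * d - 1) := by
    rw [hw1, Valuation.map_div, Valuation.map_mul, hvρ]
    have hκpos : (0 : ℤᵐ⁰) < Valued.v κ * Valued.v κ := mul_pos (hκv ▸ hξpos) (hκv ▸ hξpos)
    rw [div_le_iff₀ hκpos]
    have h1 : Valued.v (η * (ρ κ - κ)) ≤ Valued.v (jE ϖ) ^ (2 * d - 1) * (Valued.v κ * Valued.v κ) := by
      rw [Valuation.map_mul, ← mul_assoc]
      refine mul_le_mul' hηv ((Valuation.map_sub _ _ _).trans (max_le (by rw [hvρ]) le_rfl))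
    have h2 : Valued.v (η * η) ≤ Valued.v (jE ϖ) ^ (2 * d - 1) * (Valued.v κ * Valued.v κ) := by
      rw [Valuation.map_mul, ← mul_assoc]; exact mul_le_mul' hηv hηlt.le
    exact (Valuation.map_sub _ _ _).trans (max_le h1 h2)
  obtain ⟨c, hρc, hc⟩ := hdeep w hρw hΘw hwv
  refine ⟨?_, c * e, by rw [map_mul, hρc, hρe], ?_⟩
  · rw [hκ', Valuation.map_add_eq_of_lt_left _ hηlt]; exact hLv
  · have hcc : c * e * Θ (c * e) = w * ((κ + η - η) * ρ (κ + η - η) / (hM * ρ hM)) := by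
      rw [map_mul, add_sub_cancel_right, ← he, ← hc]; ring
    rw [hcc, hκ', hwdef, add_sub_cancel_right]
    field_simp

/-- **HEAD §1 — «`LIT⋆` IS CONSTANT ON `|ϖ|^{2d−1}`-BALLS OF FIXED DIGITS».**  `jE`-letters, `ρ ∘ ρ = 1`, `ρ` isometric, `Θρ = ρΘ`; the reference pair `κ₀, ξ₀`; `|ξ₀|·|cA| = |jEϖ|^b`
(the upper-line normalisation `|κ̂| = |ξ₀|`); the norm letter `hdeep` at depth `2d − 1`; `|jEϖ|^{2d−1} < 1`; `jE` GENERIC (`hjv`: integrality-reflecting, EITHER lane).  THEN for fixed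
`V, V′` with `|V′ − V| ≤ |ϖ|^{2d−1}`:
`LIT⋆ V ↔ LIT⋆ V′`, `LIT⋆ V :≡ |κ₀ + jE V·ξ₀|·|cA| = |jEϖ|^b ∧ ∃ e ∈ Fix ρ, eΘe = κ̂ρκ̂∕(hρh)`.
[cite: Serre1979, Ch. V §3 Cor. 3 pp. 85–87] [cite: Rogawski1990, §4.9 Prop. 4.9.1 (b) p. 55] [cite: Kottwitz1986BaseChangeUnits, §3] -/
theorem litStar_iff_of_near {σ : E →+* E} {ϖ : E} {d : ℕ}
    (jE : E →+* M) (hjv : ∀ c, Valued.v (jE c) ≤ 1 ↔ Valued.v c ≤ 1) (hjfix : ∀ z, ρ z = z ↔ ∃ c, jE c = z) (hΘj : ∀ c, Θ (jE c) = jE (σ c))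
    (hρρ : ∀ x, ρ (ρ x) = x) (hvρ : ∀ x, Valued.v (ρ x) = Valued.v x) (hΘρ : ∀ x, Θ (ρ x) = ρ (Θ x))
    {κ₀ ξ₀ : M} (hκ₀ : κ₀ + ρ κ₀ = 1) (hΘκ₀ : Θ κ₀ = κ₀) (hξ : ρ ξ₀ = -ξ₀) (hΘξ : Θ ξ₀ = ξ₀) (hξ0 : ξ₀ ≠ 0)
    {cA hM : M} {b : ℕ} (hRe : Valued.v ξ₀ * Valued.v cA = Valued.v (jE ϖ) ^ b) (hϖ0 : jE ϖ ≠ 0)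
    (hdeep : ∀ u : M, ρ u = u → Θ u = u → Valued.v (u - 1) ≤ Valued.v (jE ϖ) ^ (2 * d - 1) → ∃ c : M, ρ c = c ∧ c * Θ c = u)
    {V V' : E} (hσV : σ V = V) (hσV' : σ V' = V') (hnear : Valued.v (V' - V) ≤ Valued.v ϖ ^ (2 * d - 1)) (hlt : Valued.v (jE ϖ) ^ (2 * d - 1) < 1) :
    (Valued.v (κ₀ + jE V * ξ₀) * Valued.v cA = Valued.v (jE ϖ) ^ b ∧
        ∃ e : M, ρ e = e ∧ e * Θ e = (κ₀ + jE V * ξ₀) * ρ (κ₀ + jE V * ξ₀) / (hM * ρ hM)) ↔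
      (Valued.v (κ₀ + jE V' * ξ₀) * Valued.v cA = Valued.v (jE ϖ) ^ b ∧
        ∃ e : M, ρ e = e ∧ e * Θ e = (κ₀ + jE V' * ξ₀) * ρ (κ₀ + jE V' * ξ₀) / (hM * ρ hM)) := by
  have hnear' : Valued.v (V - V') ≤ Valued.v ϖ ^ (2 * d - 1) := by rw [← neg_sub, Valuation.map_neg]; exact hnear
  exact ⟨litStar_of_near jE hjv hjfix hΘj hρρ hvρ hΘρ hκ₀ hΘκ₀ hξ hΘξ hξ0 hRe hϖ0 hdeep hσV hσV' hnear hlt,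
    litStar_of_near jE hjv hjfix hΘj hρρ hvρ hΘρ hκ₀ hΘκ₀ hξ hΘξ hξ0 hRe hϖ0 hdeep hσV' hσV hnear' hlt⟩

end Summit.HodgeConjecture.HodgeConjecture.Cruxes.H413.F0P3cDyRamUpperRayDigitConstancyGen

end
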